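import Summits.Ventures.Crystal3D.Theorems.StickyWulffConstantTextureBuildWulffSupport
import Summits.Ventures.Crystal3D.Theorems.StickyWulffConstantTextureBuildBilayerFrames
import Literature.Analysis.Convexity.SupportFunction
import HarnessLib

/-!
# TB-D: support function of the WULFF BODY `wulffOf A` (continued) — the EXACT value `phiB ∘ A⁻¹`, the `√6` and `3‖ν‖` bounds, the tight frame
# of the twelve bond vectors, and CANONICAL bilayer frames as a function of the bilayer point set
# (lane T, crux `TextureLiminfV5`, stmt-Ventures-23912; design memo TB-D-0 §4 entries (A)/(D), §5 S-bricks; helper seat wulff-tb-w1, split agreed with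
# wulff-p2 g19 on the cell bus 08:49:39Z: this file CONTINUES `…TextureBuildWulffSupport` (p710089: `phiB_nonneg`, `phiB_le_sqrt_five_mul_norm`,
# `zero_mem_wulffOf`, `supportFn_wulffOf_le_phiB`, `supportFn_wulffOf_le`, `supportFn_wulffOf_le_three`) and does not redeclare those)

HONEST FRAMING. Venture `Summits/Ventures/Crystal3D` (cell `crystal3d-full`), route `route-Ventures-StickyWulffConstant`, helper
`--supports` the law-v5 crux `TextureLiminfV5` (stmt-Ventures-23912).  Elementary convex geometry and one application of choice
(census-free, standard axioms); nothing about any texture, cover or mesh; F-C1 not moved.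

* `sum_fccOffsets_inner_site_sq`, `finsum_unitVec_inner_sq` — the **tight frame identity** of the twelve nearest-neighbour vectors of
  the reference fcc lattice: `Σ_{w ∈ fccRef, ‖w‖ = 1} ⟪w, ν⟫² = 4‖ν‖²` (in cubic coordinates `Σ_{±eᵢ±eⱼ} (νᵢ ± νⱼ)²/2 = 4‖ν‖²`);
* `phiB_le_sqrt_six_mul_norm` — the memo's Cauchy–Schwarz constant `√6` (weaker than wulff-p2's `√5`, recorded for the memo's bookkeeping);
* `wulffOf_nonempty`, `bddAbove_wulffOf_inner`;
* **`supportFn_wulffOf_eq_phiB`** — `supportFn (wulffOf A) ν = phiB (A.symm ν)`: the line's surface tension IS the support function of its Wulff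
  body (attained at a moved vertex: lit `isGreatest_inner_fccWulffBody` through `wulffOf_eq_image`); hence `supportFn_wulffOf_nonneg`,
  `supportFn_wulffOf_le_sqrt_six_mul_norm`, `supportFn_wulffOf_le_three_mul_norm` (any `ν`, the homogeneous form of the support bound `3` of
  `Mesh₃.gapCost`), `supportFn_wulffOf_add_neg_le` (the symmetric facet weight `h_W(ν) + h_W(−ν) ≤ 2√5‖ν‖` of `PolytopeCalculus` (B));
* **`exists_canonicalFrame`** — ONE choice function `Φ : Set E3 → (E3 ≃ₗᵢ[ℝ] E3)` such that for every Hägg word `σ`, frame `(L, s)` and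
  index `i`, `bilayer L s σ i ⊆ (r ↦ Φ (bilayer L s σ i) r + u) '' fccRef` for some `u` (choice over wulff-p2's
  `exists_frame_bilayer_subset`): the slab-grain frame depends only on the bilayer POINT SET, so two slab grains with equal bilayers get
  literally equal frames, hence equal lattices `A '' fccRef`, hence a `c = 0` contact in the law (TB-D-0 §4 (A)); `canonicalFrame_congr`,
  `canonicalFrame_image_fccRef_eq` record the congruences.
-/

noncomputable section

open scoped BigOperators InnerProductSpace

namespace Summit.Ventures.Crystal3D.Cruxes.TextureLiminf.TexShadow

open Summit.Ventures.Crystal3D Summit.Ventures.Crystal3D.TentCertificate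
open Literature.Geometry.DiscreteGeometry (intVec intVec_apply)
open Literature.MathematicalPhysics.StatisticalMechanics (phiFcc fccWulffBody isGreatest_inner_fccWulffBody IsHaggSeq)

/-! ### The tight frame of the twelve bond vectors -/

/-- The inner product of a cubic bond vector `site δ = (√2)⁻¹·(fccPoint δ)` with `μ`, in coordinates. -/
theorem inner_site_eq (δ : Site) (μ : E3) :
    ⟪site δ, μ⟫_ℝ = (Real.sqrt 2)⁻¹ * (((fccPoint δ 0 : ℤ) : ℝ) * μ 0 + ((fccPoint δ 1 : ℤ) : ℝ) * μ 1 +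
      ((fccPoint δ 2 : ℤ) : ℝ) * μ 2) := by
  rw [site_eq, real_inner_smul_left, EuclideanSpace.inner_eq_star_dotProduct]
  simp [dotProduct, Fin.sum_univ_three, intVec, mul_comm]

/-- The squared norm in coordinates. -/
theorem norm_sq_eq_sum_three (μ : E3) : ‖μ‖ ^ 2 = μ 0 ^ 2 + μ 1 ^ 2 + μ 2 ^ 2 := by
  rw [EuclideanSpace.norm_eq, Real.sq_sqrt (Finset.sum_nonneg fun i _ => sq_nonneg _), Fin.sum_univ_three]
  simp only [Real.norm_eq_abs, sq_abs]

/-- **Tight frame, cubic coordinates**: `Σ_{δ ∈ fccOffsets} ⟪site δ, μ⟫² = 4‖μ‖²` (the twelve vectors `(±eᵢ ± eⱼ)/√2`). -/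
theorem sum_fccOffsets_inner_site_sq (μ : E3) : ∑ δ ∈ fccOffsets, ⟪site δ, μ⟫_ℝ ^ 2 = 4 * ‖μ‖ ^ 2 := by
  have h2 : ((Real.sqrt 2)⁻¹) ^ 2 = 1 / 2 := by
    rw [inv_pow, Real.sq_sqrt (by norm_num : (0 : ℝ) ≤ 2)]; norm_num
  simp only [inner_site_eq, fccOffsets, fccPoint, norm_sq_eq_sum_three]
  rw [Finset.sum_insert (by decide), Finset.sum_insert (by decide), Finset.sum_insert (by decide),
    Finset.sum_insert (by decide), Finset.sum_insert (by decide), Finset.sum_insert (by decide),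
    Finset.sum_insert (by decide), Finset.sum_insert (by decide), Finset.sum_insert (by decide),
    Finset.sum_insert (by decide), Finset.sum_insert (by decide), Finset.sum_singleton]
  simp only [Matrix.cons_val_zero, Matrix.cons_val_one, Matrix.cons_val_two, Matrix.head_cons, Matrix.tail_cons]
  push_cast
  simp only [mul_pow, h2]
  ring

/-- **Tight frame, in the reference lattice**: `Σ_{w ∈ fccRef, ‖w‖ = 1} ⟪w, ν⟫² = 4‖ν‖²` — the twelve nearest-neighbour vectors of the
fcc lattice form a tight frame with frame constant `4` (`= 12/3`). -/
theorem finsum_unitVec_inner_sq (ν : E3) : ∑ᶠ w ∈ {w | w ∈ fccRef ∧ ‖w‖ = 1}, ⟪w, ν⟫_ℝ ^ 2 = 4 * ‖ν‖ ^ 2 := by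
  have hinj : Function.Injective (fun δ : Site => toRef (site δ)) := fun a b h => site_injective (toRef.injective h)
  rw [show {w | w ∈ fccRef ∧ ‖w‖ = 1} = unitVec from rfl, unitVec_eq_image, finsum_mem_image hinj.injOn,
    finsum_mem_coe_finset]
  have h : ∀ δ ∈ fccOffsets, ⟪toRef (site δ), ν⟫_ℝ ^ 2 = ⟪site δ, toRef.symm ν⟫_ℝ ^ 2 := by
    intro δ _
    rw [← toRef.inner_map_map (site δ) (toRef.symm ν), toRef.apply_symm_apply]
  rw [Finset.sum_congr rfl h, sum_fccOffsets_inner_site_sq, LinearIsometryEquiv.norm_map]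

/-! ### The `√6` bound for `phiB` -/

/-- **`phiB ν ≤ √6·‖ν‖`** — the Cauchy–Schwarz constant `(√2/4)·√12·2` of the design memo (TB-D-0 §4 (D)); weaker than `√5`. -/
theorem phiB_le_sqrt_six_mul_norm (ν : E3) : phiB ν ≤ Real.sqrt 6 * ‖ν‖ :=
  (phiB_le_sqrt_five_mul_norm ν).trans
    (mul_le_mul_of_nonneg_right (Real.sqrt_le_sqrt (by norm_num)) (norm_nonneg ν))

/-! ### The Wulff body: support function -/

/-- `wulffOf A` is nonempty. -/
theorem wulffOf_nonempty (A : E3 ≃ₗᵢ[ℝ] E3) : (wulffOf A).Nonempty := ⟨0, zero_mem_wulffOf A⟩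

/-- The values `⟪y, ν⟫` over `wulffOf A` are bounded above. -/
theorem bddAbove_wulffOf_inner (A : E3 ≃ₗᵢ[ℝ] E3) (ν : E3) : BddAbove ((fun y : E3 => ⟪y, ν⟫_ℝ) '' wulffOf A) := by
  refine ⟨phiB (A.symm ν), ?_⟩
  rintro _ ⟨y, hy, rfl⟩
  exact hy ν

/-- **`supportFn (wulffOf A) ν = phiB (A⁻¹ ν)`**: the line's surface tension IS the support function of its Wulff body (attained at a
moved vertex of the truncated octahedron). -/
theorem supportFn_wulffOf_eq_phiB (A : E3 ≃ₗᵢ[ℝ] E3) (ν : E3) : supportFn (wulffOf A) ν = phiB (A.symm ν) := by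
  unfold supportFn
  rw [wulffOf_eq_image A, Literature.Analysis.Convexity.sSup_inner_image_image_linearIsometryEquiv,
    (isGreatest_inner_fccWulffBody _).csSup_eq, phiB_eq_phiFcc]
  rfl

/-- **`supportFn (wulffOf A) ν ≤ √6·‖ν‖`** (TB-D-0 §4 (D), §5). -/
theorem supportFn_wulffOf_le_sqrt_six_mul_norm (A : E3 ≃ₗᵢ[ℝ] E3) (ν : E3) :
    supportFn (wulffOf A) ν ≤ Real.sqrt 6 * ‖ν‖ := by
  rw [supportFn_wulffOf_eq_phiB, ← A.symm.norm_map ν]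
  exact phiB_le_sqrt_six_mul_norm _

/-- **`supportFn (wulffOf A) ν ≤ 3·‖ν‖`** — the support bound `3` of `Mesh₃.gapCost` (a designated or lateral facet with void across costs
`h_W(ν)·area ≤ 3·area` for a unit normal). -/
theorem supportFn_wulffOf_le_three_mul_norm (A : E3 ≃ₗᵢ[ℝ] E3) (ν : E3) : supportFn (wulffOf A) ν ≤ 3 * ‖ν‖ := by
  refine (supportFn_wulffOf_le_sqrt_six_mul_norm A ν).trans (mul_le_mul_of_nonneg_right ?_ (norm_nonneg ν))
  rw [show (3 : ℝ) = Real.sqrt (3 ^ 2) by rw [Real.sqrt_sq (by norm_num : (0:ℝ) ≤ 3)]]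
  exact Real.sqrt_le_sqrt (by norm_num)

/-- `0 ≤ supportFn (wulffOf A) ν`. -/
theorem supportFn_wulffOf_nonneg (A : E3 ≃ₗᵢ[ℝ] E3) (ν : E3) : 0 ≤ supportFn (wulffOf A) ν := by
  rw [supportFn_wulffOf_eq_phiB]; exact phiB_nonneg _

/-- The symmetric facet weight of `PolytopeCalculus` (B): `h_W(ν) + h_W(−ν) ≤ 2√5·‖ν‖`. -/
theorem supportFn_wulffOf_add_neg_le (A : E3 ≃ₗᵢ[ℝ] E3) (ν : E3) :
    supportFn (wulffOf A) ν + supportFn (wulffOf A) (-ν) ≤ 2 * Real.sqrt 5 * ‖ν‖ := by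
  have h1 := supportFn_wulffOf_le A ν
  have h2 := supportFn_wulffOf_le A (-ν)
  rw [norm_neg] at h2
  linarith

/-! ### Canonical bilayer frames: a frame that depends only on the bilayer point set -/

/-- **Canonical frames.**  There is ONE function `Φ` from point sets to frames such that every bilayer `B = bilayer L s σ i` of every moved
Barlow stacking with a Hägg word lies on the moved reference lattice `Φ B · fccRef + u` for some origin `u`.  Consequently the slab grains of
the texture can be framed by `A (f, i) := Φ (bilayer L_f s_f σ_f i)`, and two slab grains carrying the same bilayer POINT SET get the same frame
(`canonicalFrame_congr`), i.e. equal lattices `A '' fccRef`, i.e. a `c = 0` contact in the law. -/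
theorem exists_canonicalFrame :
    ∃ Φ : Set E3 → (E3 ≃ₗᵢ[ℝ] E3), ∀ σ : ℤ → ℤ, IsHaggSeq σ → ∀ (L : E3 ≃ₗᵢ[ℝ] E3) (s : E3) (i : ℤ),
      ∃ u : E3, bilayer L s σ i ⊆ (fun r => Φ (bilayer L s σ i) r + u) '' fccRef := by
  classical
  refine ⟨fun B => if h : ∃ (A : E3 ≃ₗᵢ[ℝ] E3) (u : E3), B ⊆ (fun r => A r + u) '' fccRef then h.choose
    else LinearIsometryEquiv.refl ℝ E3, ?_⟩
  intro σ hσ L s i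
  have h : ∃ (A : E3 ≃ₗᵢ[ℝ] E3) (u : E3), bilayer L s σ i ⊆ (fun r => A r + u) '' fccRef :=
    exists_frame_bilayer_subset hσ L s i
  simp only [dif_pos h]
  exact h.choose_spec

/-- The canonical frame of a slab grain depends only on its bilayer point set (congruence form, for rewriting under `Φ`). -/
theorem canonicalFrame_congr (Φ : Set E3 → (E3 ≃ₗᵢ[ℝ] E3)) {L L' : E3 ≃ₗᵢ[ℝ] E3} {s s' : E3} {σ σ' : ℤ → ℤ} {i i' : ℤ}
    (h : bilayer L s σ i = bilayer L' s' σ' i') : Φ (bilayer L s σ i) = Φ (bilayer L' s' σ' i') := by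
  rw [h]

/-- With canonical frames, equal bilayer point sets give equal grain lattices `A '' fccRef` (the hypothesis under which the texture law
`IsTexture` imposes no lower bound on the pair charge). -/
theorem canonicalFrame_image_fccRef_eq (Φ : Set E3 → (E3 ≃ₗᵢ[ℝ] E3)) {L L' : E3 ≃ₗᵢ[ℝ] E3} {s s' : E3} {σ σ' : ℤ → ℤ}
    {i i' : ℤ} (h : bilayer L s σ i = bilayer L' s' σ' i') :
    Φ (bilayer L s σ i) '' fccRef = Φ (bilayer L' s' σ' i') '' fccRef := by
  rw [h]

end Summit.Ventures.Crystal3D.Cruxes.TextureLiminf.TexShadow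

end
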